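import Mathlib
import HarnessLib
import HarnessLib.Audit
import Summits.Parity.Statement
import Literature.NumberTheory.Sieve.SingularSeries

/-!
Route: DeterminantMoebius

CLOSED (retired) 2026-08-15T13:49:44Z by operator:999:1257524 — reason: not-a-thesis: assembly does not conclude the sub-problem Statement — note: D-0027 §2.1 audit (human 2026-08-15: routes that do not decide the summit are removed): the assembly concludes `PairsHL`, not the sub-problem statement; a NEW conforming route may be opened from the same idea (generated `closes : … → _root_.GeneralizedHardyLittlewood`).. The file is kept as the record of this route; refuted decls are indexed as negative knowledge (`ledger negatives`).

# Route DeterminantMoebius — double Möbius opening — HL(h) = BV main term + DFI centre + Möbius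
randomness on the lines of {BC − MN = h}, cut at NC = √x

Card determinant-moebius-core (spine; addenda determinant-core-window-addendum,
determinant-eta-dial-addendum for the centre citation and exponent budget). Open BOTH von Mangoldt
factors, Λ = μ ⋆ log: for every h ≥ 1 and x, EXACTLY Σ_{n≤x} Λ(n)Λ(n+h) = Σ_{N≤x} Σ_{C≤x+h}
Σ_{M≤x/N, C | MN+h} μ(M) μ(B) log N log C with B := (MN+h)/C — Möbius on the column (M,B) of the
determinant variety {BC − MN = h}, smooth log-weights on (N,C). Sort by the Möbius variables with P
= x^{1/2−ε}, Q = x^{1/2+2ε}: MAIN {min(M,B) ≤ P} = 𝔖(h)x + o(x) (Bombieri–Vinogradov, PROVED in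
tree, + PNT: regimes (a)+(a′)−overlap = 𝔖+𝔖−𝔖); CENTRE {P < M,B ≤ Q} = o(x) (zero frequency by PNT,
the rest is Duke–Friedlander–Iwaniec's determinant theorem with the lower row general); CORE {M,B >
P, max > Q} = Σ over dilation pairs (N,C), NC < 2x^{1−ε}, of log N log C times a two-point Möbius
sum S(N,C) along the line (M,B) = (M₀+tC′, B₀+tN′). It suffices to show X = X₃ ∧ X₂: X₃
(CoreVariance) — on every dyadic shell F < NC ≤ 2F with √x ≤ F ≤ 2x^{1−ε} the weighted line sums
have mean square ≤ C x²/(F (log x)^A) for every A (a log-power below trivial: the two-point analogue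
of Barban–Davenport–Halberstam, placed exactly where the family outnumbers the line length); X₂
(DilatedChowlaLongLines) — the SIGNED sum over the ≲ √x·log x long lines NC ≤ √x is o(x). Then
Cauchy–Schwarz on the shells, the two theorem-grade regimes and the identity give PairsHL(h):
Σ_{n≤x} Λ(n)Λ(n+h) = 𝔖(h)x + o(x) for every h ≥ 1 (target shared with route TauberianTwins,
stmt-Parity-0867). UniformDilatedChowla (pointwise dilated pair-Chowla with log-power saving, level
1/2) is filed as the recognisable strengthening that implies X₂.
Lean: `(∀ h : ℕ, 1 ≤ h → ∀ ε : ℝ, 0 < ε → ε ≤ 1 / 100 → ∀ A : ℝ, 0 < A → ∃ C₀ : ℝ, ∃ x₀ : ℕ, ∀ x :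
ℕ, x₀ ≤ x → ∀ F : ℝ, Real.sqrt (x : ℝ) ≤ F → F ≤ 2 * (x : ℝ) ^ (1 - ε) → (∑ N ∈ Finset.Icc 1 x, ∑ C
∈ Finset.Icc 1 (x + h), if F < ((N * C : ℕ) : ℝ) ∧ ((N * C : ℕ) : ℝ) ≤ 2 * F then (Real.log N *
Real.log C * ∑ M ∈ Finset.Icc 1 (x / N), if C ∣ M * N + h ∧ (x : ℝ) ^ (1 / 2 - ε) < (M : ℝ) ∧ (x :
ℝ) ^ (1 / 2 - ε) < (((M * N + h) / C : ℕ) : ℝ) ∧ ((x : ℝ) ^ (1 / 2 + 2 * ε) < (M : ℝ) ∨ (x : ℝ) ^ (1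
/ 2 + 2 * ε) < (((M * N + h) / C : ℕ) : ℝ)) then (ArithmeticFunction.moebius M : ℝ) *
(ArithmeticFunction.moebius ((M * N + h) / C) : ℝ) else 0) ^ 2 else 0) ≤ C₀ * (x : ℝ) ^ 2 / (F *
Real.log x ^ A)) ∧ (∀ h : ℕ, 1 ≤ h → ∀ ε : ℝ, 0 < ε → ε ≤ 1 / 100 → (fun x : ℕ => ∑ N ∈ Finset.Icc 1
x, ∑ C ∈ Finset.Icc 1 (x + h), ∑ M ∈ Finset.Icc 1 (x / N), if C ∣ M * N + h ∧ ((N * C : ℕ) : ℝ) ≤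
Real.sqrt (x : ℝ) ∧ (x : ℝ) ^ (1 / 2 - ε) < (M : ℝ) ∧ (x : ℝ) ^ (1 / 2 - ε) < (((M * N + h) / C : ℕ)
: ℝ) ∧ ((x : ℝ) ^ (1 / 2 + 2 * ε) < (M : ℝ) ∨ (x : ℝ) ^ (1 / 2 + 2 * ε) < (((M * N + h) / C : ℕ) :
ℝ)) then (ArithmeticFunction.moebius M : ℝ) * (ArithmeticFunction.moebius ((M * N + h) / C) : ℝ) *
Real.log N * Real.log C else 0) =o[Filter.atTop] fun x : ℕ => (x : ℝ))`

## Assembly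
Bookkeeping only, given the items: fix h ≥ 1, take ε₀ from CentreKloosterman and ε = min(ε₀, 1/100).
By DeterminantIdentity the pair sum is the (N,C,M)-sum of [C | MN+h]·μ(M)μ(B)log N log C; the
indicator splits DISJOINTLY into MAIN (M ≤ P ∨ B ≤ P), CENTRE (P < M,B ≤ Q), CORE∧(NC ≤ √x),
CORE∧(NC > √x) with P = x^{1/2−ε}, Q = x^{1/2+2ε} (MAIN's complement is M,B > P, which is CENTRE ⊔
CORE). MainRegimes gives MAIN − 𝔖x = o(x), CentreKloosterman gives CENTRE = o(x),
DilatedChowlaLongLines and CoreShortLines give the two core pieces = o(x); adding, Σ_{n≤x}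
Λ(n)Λ(n+h) − 𝔖({0,h})x = o(x), which is PairsHL at h. The cruxes enter through the glue supports:
CoreVariance → CoreShortLines (VarianceToShortLines) and, optionally, UniformDilatedChowla →
DilatedChowlaLongLines (UniformToLongLines). Onward (not claimed): PairsHL → tuples by opening every
factor (card S3, Sawin–Shusterman Cor. 6.1 shape) → DimOne needs shift-uniformity |h| ≤ LN, where
Siegel-zero sensitivity enters (Literature.Barriers.Parity.SiegelZeroPrimePairBarrier) →
DicksonFibration.Assembly → Summit.Parity.GeneralizedHardyLittlewood.

Rationale: WHY THIS LINE. The double opening makes Hardy–Littlewood pairs EQUIVALENT, unconditionally, to a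
statement about μ alone on the lines of the determinant variety: every prime input is a theorem
already — Bombieri–Vinogradov (Literature.NumberTheory.Sieve.BombieriVinogradovStatement_holds,
proved in tree) for the lopsided regimes, and GL₂/Kloosterman-fraction technology for the balanced
window (DukeFriedlanderIwaniec1997Determinant = GreavesHarmanHuxley1997 ch. 6 Thm 1, PDF p.83, lower
row general / upper row smooth; DukeFriedlanderIwaniec1997 Thm 2; BettinChandee2018), whose authors
themselves place the all-general determinant problem next to twin primes (PDF p.82: it 'would … have
inopinate implications to the twin prime problem'). What remains imports multiplicative number
theory (Chowla/Elliott circle: TaoFMP2016, MatomakiRadziwillTao2015, Pilatte2026,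
HelfgottRadziwill2021) for the long lines and the dispersion/large-sieve philosophy (Linnik;
BombieriFriedlanderIwaniecActa1986; Barban–Davenport–Halberstam = CojocaruMurty2005 Thm 8.4.1, PDF
p.86) for the short lines; the cut NC = √x is where #lines ≈ line length, i.e. where a
large-sieve-type orthogonality can start to pay, so the route asks for log-power savings ONLY on
average there and confines all parity/Chowla content to ≲ √x log x long lines. Over F_q[T] the
identical architecture is a theorem (SawinShusterman2018 = arXiv:1808.04001 §6: open Λ = −Σμ·deg,
prime level 1/2+ω, uniform dilated Chowla Thm 4.5) — the evidence that the template closes. Unlike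
route MobiusShiftedPrimes (one Λ opened, needs Elliott–Halberstam) and MurtyVatwani2017, no level
beyond 1/2 is ever requested; unlike TauberianTwins no Tauberian regularity is posited; the
negatives index is empty.

RANKED CRUXES. #0 PairsHL (target) — Hardy–Littlewood pairs, Λ-form, fixed shift: for every h ≥ 1,
Σ_{n≤N} Λ(n)Λ(n+h) = 𝔖({0,h})·N + o(N). Identical signature to TauberianTwins.PairsHL
(stmt-Parity-0867; checked by `Iff.rfl` in Sketch.lean) — the endpoint of this route's Assembly; GHL
additionally needs tuples and shift-uniformity (route DicksonFibration), not claimed here. (why it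
might fail: Binary Hardy–Littlewood (1923 Conj. B, Λ-form), fixed h: open, twin-prime strength;
parity blocks sieve deductions even under EH (PrimePairParity,
bombieri_asymptotic_sieve_indeterminacy); minor arcs keep L²-mass (CircleMethodBinaryBarrier).)
[HardyLittlewood1923, GreenTao2010, Polymath8b2014, Literature.Barriers.Parity.PrimePairParity,
Literature.Barriers.Parity.CircleMethodBinaryBarrier]
#2 DilatedChowlaLongLines (crux) — Card Crux 1 restricted to the LONG lines and kept SIGNED: for
every h ≥ 1 and 0 < ε ≤ 1/100, the core terms (M > x^{1/2−ε}, B > x^{1/2−ε}, max(M,B) > x^{1/2+2ε})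
with NC ≤ √x contribute o(x) to Σ μ(M)μ(B) log N log C. These are ≲ √x·log x lines (M,B) = (M₀+tC′,
B₀+tN′) of length ≥ √x each — two-point Möbius correlations along pairs of dilated progressions,
incl. the plain Chowla directions (2,2), (2,3), … — and they carry ℓ¹ mass ≍ x log⁴x: the
parity-sensitive heart of HL(h) in this chart. [difficulty: open-problem] (why it might fail:
Contains every small direction: (N,C)=(2,2) is Σμ(M)μ(M+h/2), Cesàro binary Chowla; ℓ¹ mass ≍
x·log⁴x/384, so line-by-line proofs need (log x)^{4+δ} savings uniformly over ≍√x dilation pairs —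
only log-averaged o(1) is known (TaoFMP2016, Pilatte2026); no engine for signed cross-line
cancellation.) [TaoFMP2016, TaoTeravainenJTNB2018, Pilatte2026, HelfgottRadziwill2021,
MatomakiRadziwillTao2015, SawinShusterman2018, Literature.Barriers.Parity.PrimePairParity,
Literature.NumberTheory.Sieve.ChowlaConjecture]
#3 CoreVariance (crux) — Shellwise log-power variance bound for the SHORT lines ('BDH for Möbius
pairs on the determinant variety'): for every h ≥ 1, 0 < ε ≤ 1/100 and A > 0 there are C₀, x₀ such
that for x ≥ x₀ and every F with √x ≤ F ≤ 2x^{1−ε}, Σ_{(N,C): F < NC ≤ 2F} (log N · log C ·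
S_core(N,C))² ≤ C₀ x²/(F (log x)^A), where S_core(N,C) = Σ_{M ≤ x/N, C | MN+h, core conditions}
μ(M)μ((MN+h)/C). Trivial size is ≍ x² log⁵x/F, the random model gives ≍ x log³x; the crux asks a
log-power below trivial, uniformly in the shell, and implies no per-line cancellation (each shell
has ≳ F ≥ √x lines of length ≤ x/F ≤ √x). [difficulty: L] (why it might fail: 2-point analogue of
BDH at family size F ∈ [√x, x^{1−ε}]: BDH = Siegel–Walfisz + large sieve, neither has a 2-point
version on this line family (lines disjoint: duality empty); off-diagonal = 4-point Möbius sums with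
modular-inverse constraints; false if a positive proportion of lines is biased.) [CojocaruMurty2005,
BombieriFriedlanderIwaniecActa1986, MatomakiRadziwillTao2019, MatomakiRadziwillTao2015,
Literature.Barriers.Parity.LargeSieveLevelHalf, DukeFriedlanderIwaniec1997Determinant]
#4 UniformDilatedChowla (crux) — Pointwise strengthening that implies DilatedChowlaLongLines (glue
UniformToLongLines): for every h ≥ 1 and A > 0, uniformly over dilation pairs (N,C) with NC ≤ √x and
over initial segments y ≤ x/N, |Σ_{M ≤ y, C | MN+h} μ(M) μ((MN+h)/C)| ≤ C₀ (x/(NC)) (log x)^{-A}: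
Cesàro two-point Chowla along the rational dilation M ↦ (NM+h)/C with a log-power saving — the
dilated, level-1/2 relative of Polymath's liouvillePairAP input; (N,C) = (1,1) is Σ_{M≤y} μ(M)μ(M+h)
≪ x (log x)^{-A}. [difficulty: open-problem] (why it might fail: Pointwise Cesàro pair-Chowla along
rational dilations with (log x)^{-A} saving, uniform for NC ≤ √x and all initial segments: contains
Chowla k=2 with a log-power RATE and Polymath-type AP uniformity at level 1/2; nothing pointwise is
known even for (n,n+1); any proof must be Siegel-ineffective.) [Polymath8b2014,
Literature.Barriers.Parity.Polymath2014_liouvillePairAP, TaoFMP2016, Frantzikinakis2017,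
TaoTeravainen2021, Literature.NumberTheory.Sieve.ChowlaConjecture]
#9 DeterminantIdentity (support) — The exact double opening (provable now from Mathlib's
`ArithmeticFunction.moebius_mul_log_eq_vonMangoldt`, reindexing (n, M | n, B | n+h) ↦ (N, C, M) =
(n/M, (n+h)/B, M)): for all h, x, Σ_{n≤x} Λ(n)Λ(n+h) = Σ_{N≤x} Σ_{C≤x+h} Σ_{M≤x/N} [C | MN+h] μ(M)
μ((MN+h)/C) log N log C. [difficulty: provable-now] [Mathlib
ArithmeticFunction.moebius_mul_log_eq_vonMangoldt, BombieriAsymptoticSieve1976, SawinShusterman2018]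
#9 MainRegimes (support) — Regimes (a) ∪ (a′) carry the whole main term (theorem-grade; card S1+S2):
for h ≥ 1, 0 < ε < 1/2, the terms with M ≤ x^{1/2−ε} or B ≤ x^{1/2−ε} sum to 𝔖({0,h})·x + o(x).
Proof shape: (a) = Σ_{M ≤ P} μ(M) Σ_{N ≤ x/M} log N·Λ(MN+h) = x[(log x − 1)Σ′μ(M)/φ(M) − Σ′μ(M)log
M/φ(M)] + BV-error = 𝔖x + o(x) (Bombieri–Vinogradov at level x^{1/2−ε}, PROVED in tree, + PNT rates
for Σ_{(M,h)=1} μ(M)/φ(M) → 0 and μ(M)log M/φ(M) → −𝔖(h)); (a′) symmetric; the overlap (both ≤ P) is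
an elementary lattice count g·x/(MB) + O(1) per (M,B), g = (M,B) | h, whose main term x Σ_d
J_h(d)(μ(d)/φ(d))² equals 𝔖(h)x via g·1_{g|h} = Σ_{d|g} J_h(d), J_h(d) = Σ_{e|d, e|h} μ(d/e)e, |J_h|
≤ σ(h); inclusion–exclusion gives 𝔖+𝔖−𝔖. For odd h all three tend to 𝔖 = 0. [difficulty: L]
[Literature.NumberTheory.Sieve.BombieriVinogradovStatement_holds, Bombieri1976,
BombieriAsymptoticSieve1976, Literature.NumberTheory.Sieve.singularSeries, IwaniecKowalski2004]
#9 CentreKloosterman (support) — The balanced window is o(x) (card Crux 2, now resting on a printed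
theorem: expected provable, XL to formalise): there is ε₀ > 0 such that for 0 < ε ≤ ε₀ and h ≥ 1 the
terms with x^{1/2−ε} < M, B ≤ x^{1/2+2ε} sum to o(x). Proof shape: dyadic boxes; partition M into
(log x)^6 short ranges to decouple N ≤ x/M and smooth the cutoffs at relative scale (log x)^{-5}
(cost o(x)); apply Duke–Friedlander–Iwaniec 'Representations by the determinant' Thm 1
(DukeFriedlanderIwaniec1997Determinant, PDF p.83 of GreavesHarmanHuxley1997) with lower row (n₁,n₂)
= (M,B) carrying μ and upper row (m₁,m₂) = (C,N) carrying log-weights — here m₁n₂ = n+h and m₂n₁ =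
n, so the lopsidedness factor R is ≍ 2 identically and the error is
‖a‖‖b‖(MB)^{3/8}(M+B)^{11/48}x^{o(1)} = x^{95/96+O(ε)} = o(x) for ε ≤ ε₀ ≈ 10^{-3}; the
zero-frequency main term Σ_{g|h} Σ μ(M)μ(B) g/(MB)∫fg is O(x(log x)^{-A}) because Σ_{P<M≤Q, d|M}
μ(M)log(x/M)/M is a difference of two PNT limits. A Literature cite-fact for DFI Thm 1 is requested
(Definition requests). [difficulty: XL] [DukeFriedlanderIwaniec1997Determinant,
GreavesHarmanHuxley1997, DukeFriedlanderIwaniec1997, BettinChandee2018, FouvryRadziwill2022,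
CojocaruMurty2005]
#9 CoreShortLines (support) — The signed short-line part of the core is o(x): for h ≥ 1, 0 < ε ≤
1/100, the core terms with NC > √x contribute o(x). Implied by CoreVariance (glue
VarianceToShortLines); it is the statement the Assembly actually consumes, so a refutation of
CoreVariance alone does not break the chain. [difficulty: open-problem] [CojocaruMurty2005,
MatomakiRadziwillTao2015]
#9 VarianceToShortLines (support) — Glue (provable now, Cauchy–Schwarz): CoreVariance →
CoreShortLines. Cover √x < NC ≤ (x+h)x^{-ε} (outside this range S_core = 0 since MB > x^{1+ε}) by ≤
log₂x dyadic shells F = 2^j√x; on each, |Σ log N log C·S_core| ≤ (#{NC ≤ 2F})^{1/2}·(C₀x²/(F log^A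
x))^{1/2} ≤ (2F(1+log 2F))^{1/2}(C₀x²/(F log^A x))^{1/2} ≪ x (log x)^{(1−A)/2}; sum over shells and
take A = 4. [difficulty: provable-now] [CojocaruMurty2005]
#9 UniformToLongLines (support) — Glue (provable now): UniformDilatedChowla →
DilatedChowlaLongLines. Along a line B = (MN+h)/C is increasing in M, so the core conditions cut a
FINAL segment of {M ≤ x/N}; differencing two initial segments gives |S_core(N,C)| ≤ 2C₀(x/NC)(log
x)^{-A}; then |long-lines sum| ≤ log x·log(x+h)·Σ_{NC ≤ √x} 2C₀ x/(NC log^A x) ≪ x (log x)^{4−A} =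
o(x) with A = 5. [difficulty: provable-now] [Polymath8b2014]

TWO-LAYER PLAN. Foreseen glued splits (k ≤ 3, depth 1; nothing filed now): DilatedChowlaLongLines ⇐
SmallDirections (min(N′,C′) ≤ (log x)^B: the Chowla directions, Cesàro dilated pair-Chowla with (log
x)^{4+δ} saving for polylog-many dilations) → LargeDirections (N′,C′ > (log x)^B, NC ≤ √x: a
q-aspect analogue of Matomäki–Radziwiłł–Tao's shift-averaged Chowla over ≍ √x dilation pairs) →
DilatedChowlaLongLines. CoreVariance ⇐ OffDiagonalDispersion (expand the square: Σ_{s≠0} Σ_shell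
μ(M)μ(M+sC′)μ(B)μ(B+sN′), family summed first) → DiagonalCount → CoreVariance. CentreKloosterman ⇐
DFIWindow (the Literature cite-fact for DFI Thm 1 applied per box) → ZeroFrequencyPNT →
CentreKloosterman. MainRegimes ⇐ RegimeA_BV → OverlapCount (J_h identity = 𝔖) → MainRegimes.

KILL CRITERIA. CoreVariance REFUTED (an Ω(x²/(F (log x)^{A₀})) lower bound on some shell, i.e. a
positive proportion of biased short lines): drop the ℓ² engine, keep the chain through
CoreShortLines (restate r3 as the signed shell statement) — pivot, not close. CoreShortLines refuted
while MainRegimes and CentreKloosterman stand: then (given HL) the long lines must carry a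
compensating term — the cut at √x is wrong: resplit the core by direction size (N′,C′) instead.
DilatedChowlaLongLines refuted AND CoreShortLines proved ⇒ ¬PairsHL(h): refutes Hardy–Littlewood for
that h — file loudly, close every GHL route. UniformDilatedChowla refuted (a direction with no
log-power saving, e.g. via a Siegel-type construction) kills only r4 (drop). MainRegimes /
DeterminantIdentity / the glue items refuted = bookkeeping error: restate, never close.
CentreKloosterman refuted as quantified: shrink ε₀ or the window exponent (restate with Q =
x^{1/2+ε}). Close `superseded` if PairsHL lands through MobiusShiftedPrimes or TauberianTwins first.

NOT DECOMPOSED YET. The tuple case t ≥ 3 (open all factors: multi-point Möbius sums on lines; card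
S3) and the shift-uniform version |h| ≤ LN that DimOne needs (this is where ¬UnboundedSiegelZeros
must enter: for h ∈ qℤ the core resonates in the Siegel world, Matomäki–Merikoski); the split of the
long lines by direction size and the dispersion expansion of CoreVariance (Two-layer plan);
smoothing/partition lemmas and the PNT-rate lemmas inside MainRegimes and CentreKloosterman (provers
attach them with --supports); the formal Literature fact for DFI Thm 1 (requested); log-averaged and
almost-all-scales rungs of r2 (entropy decrement handles each fixed direction qualitatively —
TaoFMP2016 with an AP twist — but gives neither Cesàro means nor (log x)^{-4} and is not filed:
Literature.Barriers.Parity.LogarithmicAveraging).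

CHEAPEST FALSIFIER. Numerics on the line family (script numerics/detlines.py in the planner folder;
the kit socket was absent, so only a local sanity run at x = 3·10⁵, h ∈ {2,6}, ε = 0.05 was made):
per dyadic shell the ratio V/D of Σ(log N log C·S)² to its diagonal (random-model) size came out in
[0.84, 1.03] for all ten shells (square-root cancellation on average, far inside CoreVariance);
MAIN/x = 1.315 vs 𝔖(2) = 1.320 and T/x = 1.311 (h = 2); CENTRE/x = −0.0006; signed long/short core
sums +0.017x / −0.021x against ℓ¹ masses 22.6x / 72x; the small directions (2,2),(2,3),(2,4),… had
|S|/√(#terms) ≤ 2.2. The cheapest kill is the same table at x = 10⁷–10⁸ (kit, minutes): V/D growing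
like a power of log x in some shell kills CoreVariance; |S(2,2)| ≍ #terms/(log x)^{c} with c < 4 on
the Chowla directions kills any line-by-line attack on r2 (the signed statement survives). Second
cheapest: a grounder recomputes the overlap main term (J_h expansion) — if it is c·𝔖x with c ≠ 1,
MainRegimes must be restated with the window carrying a main term.

NUMBERS. P = x^{1/2−ε}, Q = x^{1/2+2ε}; core ⟹ MB > x^{1+ε} ⟹ NC < (x+h)x^{−ε}; cut at NC = √x
(#lines ≈ length). DFI Thm 1 (PDF p.83): error
‖a‖‖b‖R^{19/8}(N₁N₂)^{3/8}(N₁+N₂)^{11/48}(M₁M₂N₁N₂)^{ε′}, balanced case ‖a‖‖b‖N^{47/48}, non-trivial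
for M > N^{47/48}; in the pair problem R = M₁N₂/(M₂N₁)+M₂N₁/(M₁N₂) ≍ 2 identically (m₁n₂ = n+h, m₂n₁
= n), so the window error is x^{95/96+O(ε)} and ε₀ ≈ 10^{-3} is admissible (addenda: 1/191 via
Invent. Thm 2; 1/39 via Bettin–Chandee Cor. 1). ℓ¹ masses: long lines ≍ x log⁴x ∫∫_{u+v≤1/2} uv = x
log⁴x/384 (times a (6/π²)²-type density; measured 0.34–0.41 of x log⁴x/384 at x = 3·10⁵), short
lines the same order. BDH model (CojocaruMurty2005 Thm 8.4.1, PDF p.86): Σ_{q≤z}Σ_a |ψ(x;q,a) −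
x/φ(q)|² ≪ xz log x for x(log x)^{-A} ≤ z ≤ x. Items at open: 11 (1 target, 3 cruxes, 6 support, 1
assembly).

DEFINITION REQUESTS. No new notion is needed (all statements are inline over Mathlib +
Literature.NumberTheory.Sieve.singularSeries). Cite-fact wanted (filed right after open): `fact:
Duke–Friedlander–Iwaniec 1997, Representations by the determinant, Theorem 1`
(DukeFriedlanderIwaniec1997Determinant; lower row general, upper row smooth with f^{(j)} ≪ η^j
M^{-j}; error as in Numbers) in Literature/NumberTheory/LFunctions next to the Kloosterman files, so
that CentreKloosterman can be proved from `(h : <DFI fact>)`; and its Proposition (bilinear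
Kloosterman fractions with the e(X/mn) twist, = DukeFriedlanderIwaniec1997 Thm 2). Bib keys added
this session: DukeFriedlanderIwaniec1997Determinant, GreavesHarmanHuxley1997, Pilatte2026,
Frantzikinakis2017, HelfgottRadziwill2021, BettinChandee2018, FouvryRadziwill2022.

Novelty: Searches (2026-08-15): `lit vsearch` ×3 (pair-correlation variance over AP families / determinant
equation with Möbius / BDH statement: books only — found the held Cardiff volume book:greaves1997-…
ch.6 and CojocaruMurty2005 Thm 8.4.1; no paper on two-point variance over line or dilation
families); `lit search --source crossref|zbmath` ×8 queries ("logarithmically averaged Chowla affine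
linear forms dilated two-point" → doi:10.1007/978-3-319-55357-3_21, Frantzikinakis2017, Pilatte2026,
TaoTeravainenDuke2019; "Chowla conjecture arithmetic progressions level of distribution Liouville
pair" → nothing relevant; "bilinear Kloosterman fractions trilinear Bettin Chandee" →
DukeFriedlanderIwaniec1997, doi:10.2422/2036-2145.201805_002, FouvryRadziwill2022; "Möbius function
linear equations determinant twin primes Sawin Shusterman integers" → nothing; "correlations
multiplicative functions arithmetic progressions variance moduli Liouville" → Elliott
'Multiplicative functions on APs IV–VII' doi:10.1112/s0024610702003228 (one-point); "Representations
by the determinant …" → only the DFI 'Bounds for automorphic L-functions' series); `lit frontier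
Parity --since 2021` (30 rows; nearest doi:10.1007/s00222-026-01408-6 'Higher uniformity … II',
one-point short-interval variance); `lit bridges Parity --cross any` (generic monographs); `lit
read` of GreavesHarmanHuxley1997 pp.82–84 (Thm 1, Proposition, the twin-prime remark) and
CojocaruMurty2005 p.86; `lean search` for BV/Chowla/Kloosterman/si  [refs: 10.1007/978-3-319-55357-3_21, 10.2422/2036-2145.201805_002, 10.1112/s0024610702003228, 10.1007/s00222-026-01408-6, book:greaves1997-, doi:10.1007/978-3-319-55357-3_21, doi:10.2422/2036-2145.201805_002, doi:10.1112/s0024610702003228, doi:10.1007/s00222-026-01408-6, CojocaruMurty2005, Frantzikinakis2017, Pilatte2026, TaoTeravainenDuke2019, DukeFriedlanderIwaniec1997, FouvryRadziwill2022, GreavesHarm]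

Barriers (technique_class: determinant-equation dilated-chowla dispersion kloosterman): - technique_class: determinant-equation dilated-chowla dispersion kloosterman
- Literature.Barriers.Parity.SelbergParityBarrier: Type-I information (BV, level 1/2−ε) is used only
inside MainRegimes, which provably carries 𝔖x and nothing parity-sensitive; the decisive inputs
r2/r3 are SIGNED Möbius statements that Selberg's (1±λ)-weighted ghosts violate — the barrier is
paid for, not evaded, exactly as
Literature.NumberTheory.Sieve.bombieri_asymptotic_sieve_indeterminacy prescribes.
- Literature.Barriers.Parity.PrimePairParity: Polymath's weight-insertion test does not apply to a
deduction whose axioms are Möbius correlations on lines (ω(n) = 1−λ(n)λ(n+h) is not a function of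
the opened variables); r4 is openly of the species of the file's input Polymath2014_liouvillePairAP
(dilated, level 1/2 instead of shifts at level 1−ε) — consistent with §8's verdict that only
'bilinear/Möbius' inputs exit the barrier.
- Literature.Barriers.Parity.LargeSieveLevelHalf: every distribution statement for primes stays at
level x^{1/2−ε} (BV); beyond √x the route asks for Kloosterman-fraction cancellation (DFI, a
theorem) and Möbius-line cancellation, never for primes in progressions; CoreVariance is
deliberately placed at family size ≥ √x where large-sieve-type orthogonality is not excluded by the
barrier's Q = x^{1/2} count.
- Literature.Barriers.Parity.FordFixedLevelBarrier: no asymptotic is deduced from a fixed level;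
Ford's examples live in the core, which is attacked by signed statements,

History (route lifecycle, newest last):
- 2026-08-15T13:49:44Z · CLOSED retired — not-a-thesis: assembly does not conclude the sub-problem Statement (operator:999:1257524)

sub-problem: GeneralizedHardyLittlewood · status: closed(retired) · opened planner-plancard-Parity-GeneralizedHardyLittl-9f803cd8-0 2026-08-15T11:42:08Z · rev 0 · ledger route-Parity-DeterminantMoebius
GENERATED by the gate from the ledger (D-0016/17). Provers cite these decls: `theorem foo : Summit.Parity.GeneralizedHardyLittlewood.Theses.DeterminantMoebius.<Decl> := …` in Summits/Parity/GeneralizedHardyLittlewood/Theorems/<Name>.lean.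
-/

namespace Summit.Parity.GeneralizedHardyLittlewood.Theses.DeterminantMoebius

open scoped BigOperators Topology Manifold Classical MeasureTheory ProbabilityTheory Matrix InnerProductSpace ComplexConjugate ContinuousMap
open Filter Set Function TopologicalSpace MeasureTheory

attribute [summit_statement] _root_.GeneralizedHardyLittlewood

/-- item stmt-Parity-0867 · target · rank 0 · closed · moot by None · by planner
why it might fail: Binary Hardy–Littlewood (1923 Conj. B, Λ-form), fixed h: open, twin-prime strength; parity blocks sieve deductions even under EH (PrimePairParity, bombieri_asymptotic_sieve_indeterminacy); minor arcs keep L²-mass (CircleMethodBinaryBarrier).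
sources: HardyLittlewood1923, GreenTao2010, Polymath8b2014, Literature.Barriers.Parity.PrimePairParity, Literature.Barriers.Parity.CircleMethodBinaryBarrier
[target] Hardy–Littlewood pairs, Λ-form, fixed shift: for every h ≥ 1, ∑_{n ≤ N} Λ(n)Λ(n+h) =
𝔖({0,h}) N + o(N). The d = 1, t = 2, fixed-shift content of GHL (uniformity in h ≤ L N is NOT
claimed here; see route DicksonFibration). Open. [HardyLittlewood1923] [GreenTao2010, Example 1] -/
@[route_item "route-Parity-DeterminantMoebius"]
def PairsHL : Prop :=
  ∀ h : ℕ, 1 ≤ h → (fun N : ℕ => ∑ n ∈ Finset.Icc 1 N, ArithmeticFunction.vonMangoldt n * ArithmeticFunction.vonMangoldt (n + h) - Literature.NumberTheory.Sieve.singularSeries ({0, (h : ℤ)} : Finset ℤ) * N) =o[Filter.atTop] fun N : ℕ => (N : ℝ)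

/-- item stmt-Parity-5696 · crux · rank 2 · closed · moot by None · by planner
why it might fail: Contains every small direction: (N,C)=(2,2) is Σμ(M)μ(M+h/2), Cesàro binary Chowla; ℓ¹ mass ≍ x·log⁴x/384, so line-by-line proofs need (log x)^{4+δ} savings uniformly over ≍√x dilation pairs — only log-averaged o(1) is known (TaoFMP2016, Pilatte2026); no engine for signed cross-line cancellation.
sources: TaoFMP2016, TaoTeravainenJTNB2018, Pilatte2026, HelfgottRadziwill2021, MatomakiRadziwillTao2015, SawinShusterman2018
[crux] Card Crux 1 restricted to the LONG lines and kept SIGNED: for every h ≥ 1 and 0 < ε ≤ 1/100,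
the core terms (M > x^{1/2−ε}, B > x^{1/2−ε}, max(M,B) > x^{1/2+2ε}) with NC ≤ √x contribute o(x) to
Σ μ(M)μ(B) log N log C. These are ≲ √x·log x lines (M,B) = (M₀+tC′, B₀+tN′) of length ≥ √x each —
two-point Möbius correlations along pairs of dilated progressions, incl. the plain Chowla directions
(2,2), (2,3), … — and they carry ℓ¹ mass ≍ x log⁴x: the parity-sensitive heart of HL(h) in this
chart. [difficulty: open-problem] -/
@[route_item "route-Parity-DeterminantMoebius"]
def DilatedChowlaLongLines : Prop :=
  ∀ h : ℕ, 1 ≤ h → ∀ ε : ℝ, 0 < ε → ε ≤ 1 / 100 → (fun x : ℕ => ∑ N ∈ Finset.Icc 1 x, ∑ C ∈ Finset.Icc 1 (x + h), ∑ M ∈ Finset.Icc 1 (x / N), if C ∣ M * N + h ∧ ((N * C : ℕ) : ℝ) ≤ Real.sqrt (x : ℝ) ∧ (x : ℝ) ^ (1 / 2 - ε) < (M : ℝ) ∧ (x : ℝ) ^ (1 / 2 - ε) < (((M * N + h) / C : ℕ) : ℝ) ∧ ((x : ℝ) ^ (1 / 2 + 2 * ε) < (M : ℝ) ∨ (x :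 ℝ) ^ (1 / 2 + 2 * ε) < (((M * N + h) / C : ℕ) : ℝ)) then (ArithmeticFunction.moebius M : ℝ) * (ArithmeticFunction.moebius ((M * N + h) / C) : ℝ) * Real.log N * Real.log C else 0) =o[Filter.atTop] fun x : ℕ => (x : ℝ)

/-- item stmt-Parity-5697 · crux · rank 3 · closed · moot by None · by planner
why it might fail: 2-point analogue of BDH at family size F ∈ [√x, x^{1−ε}]: BDH = Siegel–Walfisz + large sieve, neither has a 2-point version on this line family (lines disjoint: duality empty); off-diagonal = 4-point Möbius sums with modular-inverse constraints; false if a positive proportion of lines is biased.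
sources: CojocaruMurty2005, BombieriFriedlanderIwaniecActa1986, MatomakiRadziwillTao2019, MatomakiRadziwillTao2015, Literature.Barriers.Parity.LargeSieveLevelHalf, DukeFriedlanderIwaniec1997Determinant
[crux] Shellwise log-power variance bound for the SHORT lines ('BDH for Möbius pairs on the
determinant variety'): for every h ≥ 1, 0 < ε ≤ 1/100 and A > 0 there are C₀, x₀ such that for x ≥
x₀ and every F with √x ≤ F ≤ 2x^{1−ε}, Σ_{(N,C): F < NC ≤ 2F} (log N · log C · S_core(N,C))² ≤ C₀
x²/(F (log x)^A), where S_core(N,C) = Σ_{M ≤ x/N, C | MN+h, core conditions} μ(M)μ((MN+h)/C).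
Trivial size is ≍ x² log⁵x/F, the random model gives ≍ x log³x; the crux asks a log-power below
trivial, uniformly in the shell, and implies no per-line cancellation (each shell has ≳ F ≥ √x lines
of length ≤ x/F ≤ √x). [difficulty: L] -/
@[route_item "route-Parity-DeterminantMoebius"]
def CoreVariance : Prop :=
  ∀ h : ℕ, 1 ≤ h → ∀ ε : ℝ, 0 < ε → ε ≤ 1 / 100 → ∀ A : ℝ, 0 < A → ∃ C₀ : ℝ, ∃ x₀ : ℕ, ∀ x : ℕ, x₀ ≤ x → ∀ F : ℝ, Real.sqrt (x : ℝ) ≤ F → F ≤ 2 * (x : ℝ) ^ (1 - ε) → (∑ N ∈ Finset.Icc 1 x, ∑ C ∈ Finset.Icc 1 (x + h), if F < ((N * C : ℕ) : ℝ) ∧ ((N * C : ℕ) : ℝ) ≤ 2 * F then (Real.log N * Real.log C * ∑ M ∈ Finset.Icc 1 (x / N), if C ∣ M * N + h ∧ (x : ℝ) ^ (1 / 2 - ε) < (M : ℝ) ∧ (x : ℝ) ^ (1 / 2 - ε) < (((M * N + h) / C : ℕ) : ℝ) ∧ ((x : ℝ) ^ (1 / 2 + 2 * ε) < (M : ℝ)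 ∨ (x : ℝ) ^ (1 / 2 + 2 * ε) < (((M * N + h) / C : ℕ) : ℝ)) then (ArithmeticFunction.moebius M : ℝ) * (ArithmeticFunction.moebius ((M * N + h) / C) : ℝ) else 0) ^ 2 else 0) ≤ C₀ * (x : ℝ) ^ 2 / (F * Real.log x ^ A)

/-- item stmt-Parity-5698 · crux · rank 4 · closed · moot by None · by planner
why it might fail: Pointwise Cesàro pair-Chowla along rational dilations with (log x)^{-A} saving, uniform for NC ≤ √x and all initial segments: contains Chowla k=2 with a log-power RATE and Polymath-type AP uniformity at level 1/2; nothing pointwise is known even for (n,n+1); any proof must be Siegel-ineffective.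
sources: Polymath8b2014, Literature.Barriers.Parity.Polymath2014_liouvillePairAP, TaoFMP2016, Frantzikinakis2017, TaoTeravainen2021, Literature.NumberTheory.Sieve.ChowlaConjecture
[crux] Pointwise strengthening that implies DilatedChowlaLongLines (glue UniformToLongLines): for
every h ≥ 1 and A > 0, uniformly over dilation pairs (N,C) with NC ≤ √x and over initial segments y
≤ x/N, |Σ_{M ≤ y, C | MN+h} μ(M) μ((MN+h)/C)| ≤ C₀ (x/(NC)) (log x)^{-A}: Cesàro two-point Chowla
along the rational dilation M ↦ (NM+h)/C with a log-power saving — the dilated, level-1/2 relative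
of Polymath's liouvillePairAP input; (N,C) = (1,1) is Σ_{M≤y} μ(M)μ(M+h) ≪ x (log x)^{-A}.
[difficulty: open-problem] -/
@[route_item "route-Parity-DeterminantMoebius"]
def UniformDilatedChowla : Prop :=
  ∀ h : ℕ, 1 ≤ h → ∀ A : ℝ, 0 < A → ∃ C₀ : ℝ, ∃ x₀ : ℕ, ∀ x : ℕ, x₀ ≤ x → ∀ N C : ℕ, 1 ≤ N → 1 ≤ C → ((N * C : ℕ) : ℝ) ≤ Real.sqrt (x : ℝ) → ∀ y : ℕ, y ≤ x / N → |∑ M ∈ Finset.Icc 1 y, if C ∣ M * N + h then (ArithmeticFunction.moebius M : ℝ) * (ArithmeticFunction.moebius ((M * N + h) / C) : ℝ) else 0| ≤ C₀ * ((x : ℝ) / ((N * C : ℕ) : ℝ)) / Real.log x ^ A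

/-- item stmt-Parity-5699 · support · rank 9 · closed · moot by None · by planner
sources: Mathlib ArithmeticFunction.moebius_mul_log_eq_vonMangoldt, BombieriAsymptoticSieve1976, SawinShusterman2018
[support] The exact double opening (provable now from Mathlib's
`ArithmeticFunction.moebius_mul_log_eq_vonMangoldt`, reindexing (n, M | n, B | n+h) ↦ (N, C, M) =
(n/M, (n+h)/B, M)): for all h, x, Σ_{n≤x} Λ(n)Λ(n+h) = Σ_{N≤x} Σ_{C≤x+h} Σ_{M≤x/N} [C | MN+h] μ(M)
μ((MN+h)/C) log N log C. [difficulty: provable-now] -/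
@[route_item "route-Parity-DeterminantMoebius"]
def DeterminantIdentity : Prop :=
  ∀ h x : ℕ, ∑ n ∈ Finset.Icc 1 x, ArithmeticFunction.vonMangoldt n * ArithmeticFunction.vonMangoldt (n + h) = ∑ N ∈ Finset.Icc 1 x, ∑ C ∈ Finset.Icc 1 (x + h), ∑ M ∈ Finset.Icc 1 (x / N), if C ∣ M * N + h then (ArithmeticFunction.moebius M : ℝ) * (ArithmeticFunction.moebius ((M * N + h) / C) : ℝ) * Real.log N * Real.log C else 0

/-- item stmt-Parity-5700 · support · rank 9 · closed · moot by None · by planner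
sources: Literature.NumberTheory.Sieve.BombieriVinogradovStatement_holds, Bombieri1976, BombieriAsymptoticSieve1976, Literature.NumberTheory.Sieve.singularSeries, IwaniecKowalski2004
[support] Regimes (a) ∪ (a′) carry the whole main term (theorem-grade; card S1+S2): for h ≥ 1, 0 < ε
< 1/2, the terms with M ≤ x^{1/2−ε} or B ≤ x^{1/2−ε} sum to 𝔖({0,h})·x + o(x). Proof shape: (a) =
Σ_{M ≤ P} μ(M) Σ_{N ≤ x/M} log N·Λ(MN+h) = x[(log x − 1)Σ′μ(M)/φ(M) − Σ′μ(M)log M/φ(M)] + BV-error =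
𝔖x + o(x) (Bombieri–Vinogradov at level x^{1/2−ε}, PROVED in tree, + PNT rates for Σ_{(M,h)=1}
μ(M)/φ(M) → 0 and μ(M)log M/φ(M) → −𝔖(h)); (a′) symmetric; the overlap (both ≤ P) is an elementary
lattice count g·x/(MB) + O(1) per (M,B), g = (M,B) | h, whose main term x Σ_d J_h(d)(μ(d)/φ(d))²
equals 𝔖(h)x via g·1_{g|h} = Σ_{d|g} J_h(d), J_h(d) = Σ_{e|d, e|h} μ(d/e)e, |J_h| ≤ σ(h);
inclusion–exclusion gives 𝔖+𝔖−𝔖. For odd h all three tend to 𝔖 = 0. [difficulty: L] -/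
@[route_item "route-Parity-DeterminantMoebius"]
def MainRegimes : Prop :=
  ∀ h : ℕ, 1 ≤ h → ∀ ε : ℝ, 0 < ε → ε < 1 / 2 → (fun x : ℕ => (∑ N ∈ Finset.Icc 1 x, ∑ C ∈ Finset.Icc 1 (x + h), ∑ M ∈ Finset.Icc 1 (x / N), if C ∣ M * N + h ∧ ((M : ℝ) ≤ (x : ℝ) ^ (1 / 2 - ε) ∨ (((M * N + h) / C : ℕ) : ℝ) ≤ (x : ℝ) ^ (1 / 2 - ε)) then (ArithmeticFunction.moebius M : ℝ) * (ArithmeticFunction.moebius ((M * N + h) / C) : ℝ) * Real.log N * Real.log C else 0) - Literature.NumberTheory.Sieve.singularSeries ({0, (h : ℤ)} : Finset ℤ) * (x : ℝ)) =o[Filter.atTop] fun x : ℕ => (x : ℝ)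

/-- item stmt-Parity-5701 · support · rank 9 · closed · moot by None · by planner
sources: DukeFriedlanderIwaniec1997Determinant, GreavesHarmanHuxley1997, DukeFriedlanderIwaniec1997, BettinChandee2018, FouvryRadziwill2022, CojocaruMurty2005
[support] The balanced window is o(x) (card Crux 2, now resting on a printed theorem: expected
provable, XL to formalise): there is ε₀ > 0 such that for 0 < ε ≤ ε₀ and h ≥ 1 the terms with
x^{1/2−ε} < M, B ≤ x^{1/2+2ε} sum to o(x). Proof shape: dyadic boxes; partition M into (log x)^6
short ranges to decouple N ≤ x/M and smooth the cutoffs at relative scale (log x)^{-5} (cost o(x));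
apply Duke–Friedlander–Iwaniec 'Representations by the determinant' Thm 1
(DukeFriedlanderIwaniec1997Determinant, PDF p.83 of GreavesHarmanHuxley1997) with lower row (n₁,n₂)
= (M,B) carrying μ and upper row (m₁,m₂) = (C,N) carrying log-weights — here m₁n₂ = n+h and m₂n₁ =
n, so the lopsidedness factor R is ≍ 2 identically and the error is
‖a‖‖b‖(MB)^{3/8}(M+B)^{11/48}x^{o(1)} = x^{95/96+O(ε)} = o(x) for ε ≤ ε₀ ≈ 10^{-3}; the
zero-frequency main term Σ_{g|h} Σ μ(M)μ(B) g/(MB)∫fg is O(x(log x)^{-A}) because Σ_{P<M≤Q, d|M}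
μ(M)log(x/M)/M is a difference of two PNT limits. A Literature cite-fact for DFI Thm 1 is requested
(Definition requests). [difficulty: XL] -/
@[route_item "route-Parity-DeterminantMoebius"]
def CentreKloosterman : Prop :=
  ∃ ε₀ : ℝ, 0 < ε₀ ∧ ∀ ε : ℝ, 0 < ε → ε ≤ ε₀ → ∀ h : ℕ, 1 ≤ h → (fun x : ℕ => ∑ N ∈ Finset.Icc 1 x, ∑ C ∈ Finset.Icc 1 (x + h), ∑ M ∈ Finset.Icc 1 (x / N), if C ∣ M * N + h ∧ (x : ℝ) ^ (1 / 2 - ε) < (M : ℝ) ∧ (M : ℝ) ≤ (x : ℝ) ^ (1 / 2 + 2 * ε) ∧ (x : ℝ) ^ (1 / 2 - ε) < (((M * N + h) / C : ℕ) : ℝ) ∧ (((M * N + h) / C : ℕ) : ℝ) ≤ (x : ℝ) ^ (1 / 2 + 2 * ε) then (ArithmeticFunction.moebius M : ℝ) * (ArithmeticFunction.moebius ((M * N + h) / C) : ℝ) * Real.log N * Real.log C else 0) =o[Filter.atTop] fun x : ℕ => (x : ℝ)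

/-- item stmt-Parity-5702 · support · rank 9 · closed · moot by None · by planner
sources: CojocaruMurty2005, MatomakiRadziwillTao2015
[support] The signed short-line part of the core is o(x): for h ≥ 1, 0 < ε ≤ 1/100, the core terms
with NC > √x contribute o(x). Implied by CoreVariance (glue VarianceToShortLines); it is the
statement the Assembly actually consumes, so a refutation of CoreVariance alone does not break the
chain. [difficulty: open-problem] -/
@[route_item "route-Parity-DeterminantMoebius"]
def CoreShortLines : Prop :=
  ∀ h : ℕ, 1 ≤ h → ∀ ε : ℝ, 0 < ε → ε ≤ 1 / 100 → (fun x : ℕ => ∑ N ∈ Finset.Icc 1 x, ∑ C ∈ Finset.Icc 1 (x + h), ∑ M ∈ Finset.Icc 1 (x / N), if C ∣ M * N + h ∧ Real.sqrt (x : ℝ) < ((N * C : ℕ) : ℝ) ∧ (x : ℝ) ^ (1 / 2 - ε) < (M : ℝ) ∧ (x : ℝ) ^ (1 / 2 - ε) < (((M * N + h) / C : ℕ) : ℝ) ∧ ((x : ℝ) ^ (1 / 2 + 2 * ε) < (M : ℝ) ∨ (x : ℝ) ^ (1 / 2 + 2 * ε) < (((M * N + h) / C : ℕ) : ℝ)) then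 (ArithmeticFunction.moebius M : ℝ) * (ArithmeticFunction.moebius ((M * N + h) / C) : ℝ) * Real.log N * Real.log C else 0) =o[Filter.atTop] fun x : ℕ => (x : ℝ)

/-- item stmt-Parity-5703 · support · rank 9 · closed · moot by None · by planner
sources: CojocaruMurty2005
[support] Glue (provable now, Cauchy–Schwarz): CoreVariance → CoreShortLines. Cover √x < NC ≤
(x+h)x^{-ε} (outside this range S_core = 0 since MB > x^{1+ε}) by ≤ log₂x dyadic shells F = 2^j√x;
on each, |Σ log N log C·S_core| ≤ (#{NC ≤ 2F})^{1/2}·(C₀x²/(F log^A x))^{1/2} ≤ (2F(1+log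
2F))^{1/2}(C₀x²/(F log^A x))^{1/2} ≪ x (log x)^{(1−A)/2}; sum over shells and take A = 4.
[difficulty: provable-now] -/
@[route_item "route-Parity-DeterminantMoebius"]
def VarianceToShortLines : Prop :=
  CoreVariance → CoreShortLines

/-- item stmt-Parity-5704 · support · rank 9 · closed · moot by None · by planner
sources: Polymath8b2014
[support] Glue (provable now): UniformDilatedChowla → DilatedChowlaLongLines. Along a line B =
(MN+h)/C is increasing in M, so the core conditions cut a FINAL segment of {M ≤ x/N}; differencing
two initial segments gives |S_core(N,C)| ≤ 2C₀(x/NC)(log x)^{-A}; then |long-lines sum| ≤ log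
x·log(x+h)·Σ_{NC ≤ √x} 2C₀ x/(NC log^A x) ≪ x (log x)^{4−A} = o(x) with A = 5. [difficulty:
provable-now] -/
@[route_item "route-Parity-DeterminantMoebius"]
def UniformToLongLines : Prop :=
  UniformDilatedChowla → DilatedChowlaLongLines

/-- item stmt-Parity-5705 · assembly · rank 1 · closed · moot by None · by planner
sources: HardyLittlewood1923, BombieriAsymptoticSieve1976, SawinShusterman2018, DukeFriedlanderIwaniec1997Determinant
[assembly] DeterminantIdentity → MainRegimes → CentreKloosterman → CoreShortLines →
DilatedChowlaLongLines → PairsHL (provable: disjoint split of an indicator plus four o(x)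
statements; ε := min(ε₀, 1/100)). -/
@[route_item "route-Parity-DeterminantMoebius"]
def Assembly : Prop :=
  DeterminantIdentity → MainRegimes → CentreKloosterman → CoreShortLines → DilatedChowlaLongLines → PairsHL

end Summit.Parity.GeneralizedHardyLittlewood.Theses.DeterminantMoebius
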